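import Summits.ValiantsHypothesis.ValiantsHypothesis.Theorems.GrenetZeonDualUnipotentThreeHalvesLongMassBipartiteGraftPrice
import Summits.ValiantsHypothesis.ValiantsHypothesis.Theorems.GrenetZeonDualUnipotentThreeHalvesLongMassPerPencilPrice
import Summits.ValiantsHypothesis.ValiantsHypothesis.Theorems.GrenetZeonDualUnipotentThreeHalvesLongMassTriangularTwo

/-!
# `GrenetZeon.DualUnipotentThreeHalves` (stmt-ValiantsHypothesis-24318) / `TwoDimCoefficients` (stmt-8062) —
# GRAFT ROWS BY NAME: grafts over triangularisable cores are CHEAP; graft-valued pencils never represent `per_n` below `k ≈ n^{3/2}/2`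

leafhand-val-grenetzeon-2 gen28 (29th hand), 2026-09-01; composes ✓ `…BipartiteGraftPrice.relCert_graft` (p843398) with
✓ `TriangularRow.relCert_of_triangularisable_two` (price `2⌊√n⌋k` on the triangularisable locus) and the PER-PENCIL PRICE BRIDGE
✓ `PerPencilPrice.le_of_relCert_of_perPoly_eq_trace` (a `per_n`-representing pencil has price exactly the window cap `n(n−1)`).

* `relCert_graft_of_triangularisable` — the graft `G` of affine `Tp` (ARBITRARY), `sp` onto a core `Np` that ONE constant unit strictly
  triangularises has `RelCert n m G (2⌊√n⌋k + 2n + 1)`: the fat ∧ long ∧ IRREDUCIBLE graft spaces over `𝔫_k` (✓ `graft_irreducible`, dim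
  `≈ b²/6`, index `≈ 2b/3`, `b = 3k`) are CHEAP at constant `c = 2 + o(1)` — NOT (c)-violators.
* `le_of_graft_perPoly_eq_trace` — (24318/8062 ROW) if `per_n = tr(G^{n−1}·M)` with `M` affine and `G` a graft over a core of price `P`, then
  `n(n−1) ≤ P + 2n + 1`; `le_of_graft_triangularisable_perPoly_eq_trace` — over a triangularisable core `n(n−1) ≤ 2⌊√n⌋k + 2n + 1`, i.e. the core
  size must be `k ≳ n^{3/2}/2` (total width `m = 3k ≳ 1.5·n^{3/2}`): the graft species joins gauge / triangular / Engel / word pencils on the list of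
  named species excluded as small trace-power representations of the permanent.

Honest framing.  Helper rows (`--supports stmt-ValiantsHypothesis-24318`); nothing here proves (c), S3, 24318, 8062 or `VP ≠ VNP` — all OPEN /
NOT proved.  No definitions, no sorry, standard axioms.
-/

set_option linter.dupNamespace false
set_option autoImplicit false

namespace Summit.ValiantsHypothesis.ValiantsHypothesis.Theorems.GrenetZeon.BipartiteGraft

open MvPolynomial Matrix
open scoped BigOperators
open Literature.Computability.AlgebraicComplexity (perPoly)
open Summit.ValiantsHypothesis.ValiantsHypothesis.Cruxes.TwoDimCoefficients.DimTwoCases (AffMat IsAffine)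
open Summit.ValiantsHypothesis.ValiantsHypothesis.Theorems.GrenetZeon.SlowCore (RelCert)
open Summit.ValiantsHypothesis.ValiantsHypothesis.Theorems.GrenetZeon.PerPencilPrice (le_of_relCert_of_perPoly_eq_trace)
open Summit.ValiantsHypothesis.ValiantsHypothesis.Theorems.GrenetZeon.TriangularRow (relCert_of_triangularisable_two)

variable {n k m : ℕ} {e : Fin k ⊕ (Fin k ⊕ Fin k) ≃ Fin m} {Tp Np : AffMat n k} {sp : MvPolynomial (Fin n × Fin n) ℂ}

/-- ★ **Grafts over a triangularisable core are cheap**: if one constant unit strictly triangularises the core `Np`, the graft of an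
ARBITRARY affine `Tp` and an affine scalar `sp` onto it has price `≤ 2⌊√n⌋k + 2n + 1`. -/
theorem relCert_graft_of_triangularisable (hT : IsAffine Tp) (hNa : IsAffine Np) (hs : sp.totalDegree ≤ 1)
    (P : (Matrix (Fin k) (Fin k) ℂ)ˣ)
    (htri : ∀ i j : Fin k, j ≤ i →
      ((P : Matrix (Fin k) (Fin k) ℂ).map C * Np * (↑P⁻¹ : Matrix (Fin k) (Fin k) ℂ).map C : AffMat n k) i j = 0)
    (G : AffMat n m)
    (hG : G = Matrix.reindex e e (fromBlocks 0
      (fromCols (sp • (1 : Matrix (Fin k) (Fin k) (MvPolynomial (Fin n × Fin n) ℂ))) (Tp + Np))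
      (fromRows Tp (-(sp • (1 : Matrix (Fin k) (Fin k) (MvPolynomial (Fin n × Fin n) ℂ))))) 0)) :
    RelCert n m G (2 * (Nat.sqrt n * k) + 2 * n + 1) :=
  relCert_graft hT hNa hs (relCert_of_triangularisable_two Np hNa P htri) G hG

/-- ★ **24318/8062 ROW for grafts**: a graft `G` over a core `Np` of price `P` that represents the permanent, `per_n = tr(G^{n−1}·M)` with `M`
affine, forces `n(n−1) ≤ P + 2n + 1` (the per-pencil price bridge: a representing pencil has price exactly `n(n−1)`). -/
theorem le_of_graft_perPoly_eq_trace (hT : IsAffine Tp) (hNa : IsAffine Np) (hs : sp.totalDegree ≤ 1) {P : ℕ}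
    (hR : RelCert n k Np P) (G : AffMat n m)
    (hG : G = Matrix.reindex e e (fromBlocks 0
      (fromCols (sp • (1 : Matrix (Fin k) (Fin k) (MvPolynomial (Fin n × Fin n) ℂ))) (Tp + Np))
      (fromRows Tp (-(sp • (1 : Matrix (Fin k) (Fin k) (MvPolynomial (Fin n × Fin n) ℂ))))) 0))
    (M : AffMat n m) (hM : IsAffine M) (hper : perPoly (Fin n) ℂ = (G ^ (n - 1) * M).trace) :
    n * (n - 1) ≤ P + 2 * n + 1 :=
  le_of_relCert_of_perPoly_eq_trace G M hM hper (relCert_graft hT hNa hs hR G hG)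

/-- ★ **Triangularisable-core version**: `per_n = tr(G^{n−1}·M)` with `G` a graft over a core strictly triangularised by one constant unit
forces `n(n−1) ≤ 2⌊√n⌋k + 2n + 1` — the core size must be `k ≳ n^{3/2}/2` although the graft space itself is fat, long and irreducible. -/
theorem le_of_graft_triangularisable_perPoly_eq_trace (hT : IsAffine Tp) (hNa : IsAffine Np) (hs : sp.totalDegree ≤ 1)
    (P : (Matrix (Fin k) (Fin k) ℂ)ˣ)
    (htri : ∀ i j : Fin k, j ≤ i →
      ((P : Matrix (Fin k) (Fin k) ℂ).map C * Np * (↑P⁻¹ : Matrix (Fin k) (Fin k) ℂ).map C : AffMat n k) i j = 0)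
    (G : AffMat n m)
    (hG : G = Matrix.reindex e e (fromBlocks 0
      (fromCols (sp • (1 : Matrix (Fin k) (Fin k) (MvPolynomial (Fin n × Fin n) ℂ))) (Tp + Np))
      (fromRows Tp (-(sp • (1 : Matrix (Fin k) (Fin k) (MvPolynomial (Fin n × Fin n) ℂ))))) 0))
    (M : AffMat n m) (hM : IsAffine M) (hper : perPoly (Fin n) ℂ = (G ^ (n - 1) * M).trace) :
    n * (n - 1) ≤ 2 * (Nat.sqrt n * k) + 2 * n + 1 :=
  le_of_relCert_of_perPoly_eq_trace G M hM hper (relCert_graft_of_triangularisable hT hNa hs P htri G hG)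

end Summit.ValiantsHypothesis.ValiantsHypothesis.Theorems.GrenetZeon.BipartiteGraft
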